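import Literature.NumberTheory.LFunctions.UniformClassGroupPNTGeneralDegree
import Literature.NumberTheory.LFunctions.UniformClassGroupPNTGeneralDegreeInputs
import Literature.NumberTheory.LFunctions.LogIntegralStrictMonoProofs
import Literature.NumberTheory.LFunctions.LogIntegralProofs
import Literature.NumberTheory.LFunctions.PrimeIdealTheorem
import HarnessLib

/-!
# Crux `DegreeOnePrimesEscape` (stmt-QuantumAdvantage-11543) — dock, part 1: the upper shadow

Route `LinnikCubicClassGroups`, crux `DegreeOnePrimesEscape`
(`∀ n, ∃ C, ∀ K` of degree `n` without quadratic subfield, `∀ x ≥ |d_K|^C`, `∀ M < Cl(𝓞 K)` proper: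
`π(x) ≤ 8 · #{P : N P prime ≤ x, [P] ∉ M}`).

This is part 1 of the landing, under `Theorems/`, of the sorry-free CONDITIONAL proof of the crux
from the two named Literature facts `ThornerZaman2019_classPNT_hilbertClassField` (TZ 2019 Thm 1.4
for the Hilbert class field) and Stark's no-quadratic-subfield non-vanishing (originally the crux
workfile `Cruxes/DegreeOnePrimesEscape/IdeatorSketchR1I3.lean`, ideator r1/i3, re-checked by the
disprover gen 3 and three triagers; every line of the crux docks into it).  Part 1 proves the
**upper shadow** from the TZ fact: there is an absolute `C₀` such that for every number field `K`
of degree `> 1`, every `x ≥ Q^{C₀}` (`Q = |d_K|·n_K^{n_K}`) and EVERY subgroup `M ≤ Cl(K)`,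
`32 · [Cl(K):M] · #{𝔭 prime, N𝔭 ≤ x, [𝔭] ∈ M} ≤ 33 · Li(x)` — registered stub `stub_upperShadow`
of the lead's skeleton (line `dedekind-s3-collision`, reshaped: the dock became stubs 7–9).
It is sign-immune: `∑_{C ∈ M} Re χ₁(C) ≥ 0` for every character (`sum_subgroup_char_re_nonneg`),
so the exceptional `Li(x^{β₁})` term of the Thorner–Zaman dichotomy enters the count of primes IN
a subgroup with a non-positive coefficient and is dropped; the relative error is `≤ 1/32` once
`x ≥ Q^{C₀}` (`errorTermN_le_of_ge`).

Parts 2 (`…LowerShadow.lean`, stub `stub_lowerShadow`: `29·Li ≤ 32·π_K` at polynomial height, from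
TZ + Stark) and 3 (`…Composition.lean`, stub `stub_shadowsComposition`: the counting that turns the two
shadows into the crux inequality) complete the dock.
-/

noncomputable section

open scoped NumberField nonZeroDivisors
open Literature.NumberTheory.LFunctions Literature.NumberTheory.LFunctions.NumberField

namespace Summit.QuantumAdvantage.QuantumAdvantage.Theorems.DegreeOnePrimesEscape.Dock


/-- **The sign lemma (the lever in its purest form; PROVED).** For every character `χ` of a
finite abelian group and every subgroup `M`, `∑_{C ∈ M} Re χ(C) ≥ 0` (the sum is `|M|` if
`χ|_M = 1` and `0` otherwise, Mathlib `sum_hom_units_eq_zero`).  Applied to the exceptional real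
class-group character `χ₁` of the Thorner–Zaman dichotomy, the `Li(x^{β₁})`-term of
`∑_{C ∈ M} π_C(x)` carries the coefficient `-∑_{C∈M} χ₁(C)/h ≤ 0` and is DROPPED: the count of
primes in a subgroup never sees an exceptional zero from below. [folklore] -/
theorem sum_subgroup_char_re_nonneg {G : Type*} [CommGroup G] [Fintype G]
    (M : Subgroup G) [DecidablePred (· ∈ M)] (χ : G →* ℂˣ) :
    0 ≤ ∑ C ∈ Finset.univ.filter (· ∈ M), ((χ C : ℂ)).re := by
  classical
  set ψ : M →* ℂ := (Units.coeHom ℂ).comp (χ.comp M.subtype) with hψ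
  have hsum : ∑ C ∈ Finset.univ.filter (· ∈ M), ((χ C : ℂ)).re = ∑ m : M, (ψ m).re := by
    rw [Finset.sum_subtype (Finset.univ.filter (· ∈ M)) (p := (· ∈ M)) (by simp)]
    rfl
  rw [hsum, ← Complex.re_sum]
  by_cases h1 : ψ = 1
  · simp [h1]
  · rw [sum_hom_units_eq_zero ψ h1]
    simp

/-- `log Q ≥ n log 2` for `Q = |d_K| n^n`, `n = [K:ℚ] ≥ 2`. [folklore] -/
theorem finrank_mul_log_two_le_log_condQn (K : Type) [Field K] [NumberField K]
    (hK : 1 < Module.finrank ℚ K) :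
    (Module.finrank ℚ K : ℝ) * Real.log 2 ≤ Real.log (ThornerZaman.condQn K) := by
  have hn : (2 : ℝ) ≤ Module.finrank ℚ K := by exact_mod_cast hK
  have hd : (1 : ℝ) ≤ |(NumberField.discr K : ℝ)| := by
    rw [← Int.cast_abs]; exact_mod_cast Int.one_le_abs (NumberField.discr_ne_zero K)
  have hnpos : (0 : ℝ) < Module.finrank ℚ K := by linarith
  unfold ThornerZaman.condQn
  rw [Real.log_mul (by linarith) (by positivity), Real.log_pow]
  have h1 : 0 ≤ Real.log |(NumberField.discr K : ℝ)| := Real.log_nonneg hd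
  have h2 : Real.log 2 ≤ Real.log (Module.finrank ℚ K : ℝ) := Real.log_le_log (by norm_num) hn
  nlinarith

/-- The uniform error bound: with `L = max 1 (log (64 c₃))` and
`C₀ ≥ max (L/c₂) (L²/(c₂ log 2))`, for every `K` of degree `> 1` and `x ≥ Q^{C₀}`:
`c₃ · E(x) ≤ 1/32`. [folklore] -/
theorem errorTermN_le_of_ge {c₂ c₃ C₀ : ℝ} (hc₂ : 0 < c₂) (hc₃ : 0 < c₃)
    (hC₁ : max 1 (Real.log (64 * c₃)) / c₂ ≤ C₀)
    (hC₂ : (max 1 (Real.log (64 * c₃))) ^ 2 / (c₂ * Real.log 2) ≤ C₀)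
    (K : Type) [Field K] [NumberField K] (hK : 1 < Module.finrank ℚ K)
    {x : ℝ} (hx : ThornerZaman.condQn K ^ C₀ ≤ x) :
    c₃ * ThornerZaman.errorTermN c₂ (ThornerZaman.condQn K) (Module.finrank ℚ K) x ≤ 1 / 32 := by
  set L : ℝ := max 1 (Real.log (64 * c₃)) with hLdef
  set Q : ℝ := ThornerZaman.condQn K with hQdef
  set n : ℕ := Module.finrank ℚ K with hndef
  have hL1 : 1 ≤ L := le_max_left _ _
  have hL0 : 0 < L := by linarith
  have hQ12 : 12 ≤ Q := ThornerZaman.twelve_le_condQn (K := K) hK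
  have hQpos : 0 < Q := by linarith
  have hlogQ : 0 < Real.log Q := Real.log_pos (by linarith)
  have hC₀pos : 0 < C₀ := lt_of_lt_of_le (by positivity) hC₁
  have hxpos : 0 < x := lt_of_lt_of_le (Real.rpow_pos_of_pos hQpos _) hx
  have hlogx : C₀ * Real.log Q ≤ Real.log x := by
    have := Real.log_le_log (Real.rpow_pos_of_pos hQpos _) hx
    rwa [Real.log_rpow hQpos] at this
  have hlog2 : (0 : ℝ) < Real.log 2 := Real.log_pos (by norm_num)
  -- term 1
  have hT1 : Real.exp (-(c₂ * Real.log x / Real.log Q)) ≤ Real.exp (-L) := by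
    apply Real.exp_le_exp.mpr
    have h1 : L ≤ c₂ * C₀ := by
      have := (div_le_iff₀ hc₂).1 hC₁; linarith
    have h2 : c₂ * C₀ ≤ c₂ * Real.log x / Real.log Q := by
      rw [le_div_iff₀ hlogQ]; nlinarith
    linarith
  -- term 2
  have hnlog : (n : ℝ) * Real.log 2 ≤ Real.log Q := finrank_mul_log_two_le_log_condQn K hK
  have h2n : (2 : ℝ) ≤ n := by exact_mod_cast hK
  have hn0 : (0 : ℝ) < n := by linarith
  have hT2 : Real.exp (-(Real.sqrt (c₂ * Real.log x) / Real.sqrt n)) ≤ Real.exp (-L) := by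
    apply Real.exp_le_exp.mpr
    have hsq : L ^ 2 ≤ c₂ * Real.log x / n := by
      rw [le_div_iff₀ hn0]
      have h1 : L ^ 2 ≤ C₀ * (c₂ * Real.log 2) := by
        have := (div_le_iff₀ (by positivity)).1 hC₂; linarith
      have h2 : C₀ * (c₂ * Real.log 2) * n ≤ c₂ * (C₀ * Real.log Q) := by nlinarith
      nlinarith
    have hge : L ≤ Real.sqrt (c₂ * Real.log x) / Real.sqrt n := by
      rw [← Real.sqrt_div' _ hn0.le]  -- √a / √n = √(a/n)? check orientation
      calc L = Real.sqrt (L ^ 2) := by rw [Real.sqrt_sq hL0.le]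
        _ ≤ Real.sqrt (c₂ * Real.log x / n) := Real.sqrt_le_sqrt hsq
    linarith
  have hexpL : Real.exp (-L) ≤ 1 / (64 * c₃) := by
    have : Real.log (64 * c₃) ≤ L := le_max_right _ _
    calc Real.exp (-L) ≤ Real.exp (-Real.log (64 * c₃)) := Real.exp_le_exp.mpr (by linarith)
      _ = 1 / (64 * c₃) := by rw [Real.exp_neg, Real.exp_log (by positivity), one_div]
  unfold ThornerZaman.errorTermN
  have hsum : Real.exp (-(c₂ * Real.log x / Real.log Q)) +
      Real.exp (-(Real.sqrt (c₂ * Real.log x) / Real.sqrt n)) ≤ 2 * (1 / (64 * c₃)) := by linarith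
  calc c₃ * (Real.exp (-(c₂ * Real.log x / Real.log Q)) +
        Real.exp (-(Real.sqrt (c₂ * Real.log x) / Real.sqrt ↑n)))
      ≤ c₃ * (2 * (1 / (64 * c₃))) := by gcongr
    _ = 1 / 32 := by field_simp; ring

open Classical in
/-- **F_up in sum form, PROVED from the Thorner–Zaman named fact** (the card's depth 0): for an
absolute `C₀`, every `K` of degree `> 1`, `x ≥ Q^{C₀}` and subgroup `M ≤ Cl(K)`:
`32 · [Cl:M] · ∑_{C ∈ M} π_C(x) ≤ 33 · Li(x)`. -/
theorem subgroupClassSum_le_of_TZ (hTZ : ThornerZaman2019_classPNT_hilbertClassField) :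
    ∃ C₀ : ℝ, ∀ (K : Type) [Field K] [NumberField K], 1 < Module.finrank ℚ K →
      ∀ x : ℝ, ThornerZaman.condQn K ^ C₀ ≤ x →
      ∀ M : Subgroup (ClassGroup (𝓞 K)),
        32 * (M.index : ℝ) * ∑ C ∈ Finset.univ.filter (· ∈ M), (primeIdealClassCount K C x : ℝ)
          ≤ 33 * offsetLogIntegral x := by
  obtain ⟨c₁, c₂, c₃, hc₁, hc₂, hc₃, H⟩ := hTZ
  set L : ℝ := max 1 (Real.log (64 * c₃)) with hLdef
  refine ⟨max (max c₁ 1) (max (L / c₂) (L ^ 2 / (c₂ * Real.log 2))), ?_⟩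
  intro K _ _ hK x hx M
  set C₀ : ℝ := max (max c₁ 1) (max (L / c₂) (L ^ 2 / (c₂ * Real.log 2))) with hC₀def
  set Q : ℝ := ThornerZaman.condQn K with hQdef
  set h : ℕ := NumberField.classNumber K with hhdef
  have hQ12 : 12 ≤ Q := ThornerZaman.twelve_le_condQn (K := K) hK
  have hQ1 : 1 ≤ Q := by linarith
  have hC₀c₁ : c₁ ≤ C₀ := le_trans (le_max_left _ _) (le_max_left _ _)
  have hC₀1 : 1 ≤ C₀ := le_trans (le_max_right _ _) (le_max_left _ _)
  have hxc₁ : Q ^ c₁ ≤ x := le_trans (Real.rpow_le_rpow_of_exponent_le hQ1 hC₀c₁) hx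
  have hx12 : 12 ≤ x := by
    calc (12 : ℝ) ≤ Q := hQ12
      _ = Q ^ (1 : ℝ) := (Real.rpow_one Q).symm
      _ ≤ Q ^ C₀ := Real.rpow_le_rpow_of_exponent_le hQ1 hC₀1
      _ ≤ x := hx
  have hE : c₃ * ThornerZaman.errorTermN c₂ Q (Module.finrank ℚ K) x ≤ 1 / 32 :=
    errorTermN_le_of_ge hc₂ hc₃ (le_trans (le_max_left _ _) (le_max_right _ _))
      (le_trans (le_max_right _ _) (le_max_right _ _)) K hK hx
  have hEpos : 0 < c₃ * ThornerZaman.errorTermN c₂ Q (Module.finrank ℚ K) x :=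
    mul_pos hc₃ (ThornerZaman.errorTermN_pos _ _ _ _)
  -- Li(x) ≥ 0 and Li(x^β) ≥ 0 for β ≥ 1/2
  have hLimono := strictMonoOn_offsetLogIntegral_holds
  have hLi_nonneg : ∀ y : ℝ, 2 ≤ y → 0 ≤ offsetLogIntegral y := by
    intro y hy
    rcases eq_or_lt_of_le hy with h2 | h2
    · rw [← h2, offsetLogIntegral_two]
    · have := hLimono (show (2:ℝ) ∈ Set.Ioi 1 by norm_num) (show y ∈ Set.Ioi 1 from by
        simp only [Set.mem_Ioi]; linarith) h2
      rw [offsetLogIntegral_two] at this; exact this.le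
  have hLix : 0 ≤ offsetLogIntegral x := hLi_nonneg x (by linarith)
  -- index · |M| = h
  have hF : ((Finset.univ.filter (· ∈ M)).card : ℝ) * (M.index : ℝ) = h := by
    have h1 : (Finset.univ.filter (· ∈ M)).card = Nat.card M := by
      rw [Nat.card_eq_fintype_card, ← Fintype.card_subtype]
    have h2 : Nat.card M * M.index = Nat.card (ClassGroup (𝓞 K)) := Subgroup.card_mul_index M
    have h3 : Nat.card (ClassGroup (𝓞 K)) = h := by
      rw [hhdef, NumberField.classNumber, Nat.card_eq_fintype_card]
    rw [h1]
    exact_mod_cast h2.trans h3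
  have hhpos : (0 : ℝ) < h := by exact_mod_cast NumberField.classNumber_pos (K := K)
  -- a per-class bound `π_C ≤ (33/32) m_C` from `|π_C − m_C| ≤ c₃ E m_C`
  have key : ∀ (π m : ℝ), |π - m| ≤ c₃ * ThornerZaman.errorTermN c₂ Q (Module.finrank ℚ K) x * m →
      π ≤ 33 / 32 * m := by
    intro π m hπ
    have hm : 0 ≤ m := by
      by_contra hneg
      rw [not_le] at hneg
      have : c₃ * ThornerZaman.errorTermN c₂ Q (Module.finrank ℚ K) x * m < 0 := mul_neg_of_pos_of_neg hEpos hneg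
      linarith [abs_nonneg (π - m)]
    have h1 := (abs_sub_le_iff.1 hπ).1
    nlinarith
  rcases H K hK with ⟨-, hA⟩ | ⟨χ₁, β₁, -, hβlo, hβhi, -, hB⟩
  · -- no exceptional zero
    have hC : ∀ C : ClassGroup (𝓞 K),
        (primeIdealClassCount K C x : ℝ) ≤ 33 / 32 * (offsetLogIntegral x / h) :=
      fun C => key _ _ (hA C x hxc₁)
    calc 32 * (M.index : ℝ) * ∑ C ∈ Finset.univ.filter (· ∈ M), (primeIdealClassCount K C x : ℝ)
        ≤ 32 * (M.index : ℝ) * ∑ C ∈ Finset.univ.filter (· ∈ M), 33 / 32 * (offsetLogIntegral x / h) := by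
          gcongr with C hC'
          exact hC C
      _ = 33 * offsetLogIntegral x * (((Finset.univ.filter (· ∈ M)).card : ℝ) * (M.index : ℝ) / h) := by
          rw [Finset.sum_const, nsmul_eq_mul]; ring
      _ = 33 * offsetLogIntegral x := by rw [hF, div_self hhpos.ne', mul_one]
  · -- exceptional (χ₁, β₁)
    have hβhalf : (1:ℝ) / 2 ≤ β₁ := by
      have hlogQ : Real.log 12 ≤ Real.log Q := Real.log_le_log (by norm_num) hQ12
      have hlog12 : (1 : ℝ) < Real.log 12 := by
        have := Real.exp_one_lt_d9
        rw [Real.lt_log_iff_exp_lt (by norm_num)]; linarith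
      have hlogQpos : 0 < Real.log Q := by linarith
      have : 1 / (8 * Real.log Q) ≤ 1 / 8 := by
        rw [div_le_div_iff₀ (by positivity) (by norm_num)]; nlinarith
      linarith
    have hxβ : 2 ≤ x ^ β₁ := by
      have hx1 : (1:ℝ) ≤ x := by linarith
      calc (2 : ℝ) ≤ 12 ^ ((1:ℝ) / 2) := by
            rw [show (12:ℝ) = 2 ^ (2:ℝ) * 3 by norm_num, Real.mul_rpow (by positivity) (by norm_num),
              ← Real.rpow_mul (by norm_num)]
            norm_num
            have : (1:ℝ) ≤ (3:ℝ) ^ ((1:ℝ)/2) := Real.one_le_rpow (by norm_num) (by norm_num)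
            linarith
        _ ≤ x ^ ((1:ℝ) / 2) := Real.rpow_le_rpow (by norm_num) hx12 (by norm_num)
        _ ≤ x ^ β₁ := Real.rpow_le_rpow_of_exponent_le hx1 hβhalf
    have hLiβ : 0 ≤ offsetLogIntegral (x ^ β₁) := hLi_nonneg _ hxβ
    have hC : ∀ C : ClassGroup (𝓞 K), (primeIdealClassCount K C x : ℝ) ≤
        33 / 32 * ((offsetLogIntegral x - ((χ₁ C : ℂ)).re * offsetLogIntegral (x ^ β₁)) / h) :=
      fun C => key _ _ (hB C x hxc₁)
    have hsign : 0 ≤ ∑ C ∈ Finset.univ.filter (· ∈ M), ((χ₁ C : ℂ)).re :=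
      sum_subgroup_char_re_nonneg M χ₁
    set F := Finset.univ.filter (· ∈ M) with hFdef
    have hsum : ∑ C ∈ F, (offsetLogIntegral x - ((χ₁ C : ℂ)).re * offsetLogIntegral (x ^ β₁)) / (h : ℝ)
        = ((F.card : ℝ) * offsetLogIntegral x
            - (∑ C ∈ F, ((χ₁ C : ℂ)).re) * offsetLogIntegral (x ^ β₁)) / h := by
      rw [← Finset.sum_div, Finset.sum_sub_distrib, Finset.sum_const, nsmul_eq_mul, Finset.sum_mul]
    have hdrop : ((F.card : ℝ) * offsetLogIntegral x
            - (∑ C ∈ F, ((χ₁ C : ℂ)).re) * offsetLogIntegral (x ^ β₁)) / h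
          ≤ (F.card : ℝ) * offsetLogIntegral x / h := by
      apply div_le_div_of_nonneg_right _ hhpos.le
      nlinarith [mul_nonneg hsign hLiβ]
    calc 32 * (M.index : ℝ) * ∑ C ∈ F, (primeIdealClassCount K C x : ℝ)
        ≤ 32 * (M.index : ℝ) * ∑ C ∈ F,
            33 / 32 * ((offsetLogIntegral x - ((χ₁ C : ℂ)).re * offsetLogIntegral (x ^ β₁)) / h) := by
          gcongr with C hC'
          exact hC C
      _ = 32 * (M.index : ℝ) * (33 / 32 * (((F.card : ℝ) * offsetLogIntegral x
            - (∑ C ∈ F, ((χ₁ C : ℂ)).re) * offsetLogIntegral (x ^ β₁)) / h)) := by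
          rw [← Finset.mul_sum, hsum]
      _ ≤ 32 * (M.index : ℝ) * (33 / 32 * ((F.card : ℝ) * offsetLogIntegral x / h)) := by
          have hcoef : 0 ≤ 32 * (M.index : ℝ) := by positivity
          apply mul_le_mul_of_nonneg_left _ hcoef
          nlinarith [hdrop]
      _ = 33 * offsetLogIntegral x * ((F.card : ℝ) * (M.index : ℝ) / h) := by ring
      _ = 33 * offsetLogIntegral x := by rw [hF, div_self hhpos.ne', mul_one]


open Classical in
/-- **Fibrewise count**: the primes of norm `≤ x` whose class lies in a finset `T` of classes are
counted class by class by the tree's `primeIdealClassCount`. [folklore] -/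
theorem ncard_primes_class_mem_eq_sum (K : Type) [Field K] [NumberField K] (x : ℝ)
    (T : Finset (ClassGroup (𝓞 K))) :
    Set.ncard {P : Ideal (𝓞 K) | P.IsPrime ∧ (Ideal.absNorm P : ℝ) ≤ x ∧
        ∃ hP : P ∈ (Ideal (𝓞 K))⁰, ClassGroup.mk0 ⟨P, hP⟩ ∈ T}
      = ∑ C ∈ T, primeIdealClassCount K C x := by
  set S : Set (Ideal (𝓞 K)) := {P : Ideal (𝓞 K) | P.IsPrime ∧ (Ideal.absNorm P : ℝ) ≤ x ∧
        ∃ hP : P ∈ (Ideal (𝓞 K))⁰, ClassGroup.mk0 ⟨P, hP⟩ ∈ T} with hSdef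
  have hSfin : S.Finite := by
    refine (finite_primeIdealsLE K x).subset ?_
    rintro P ⟨h1, h2, hP, -⟩
    exact ⟨h1, nonZeroDivisors.ne_zero hP, h2⟩
  rw [Set.ncard_eq_toFinset_card S hSfin]
  rw [Finset.card_eq_sum_card_fiberwise (f := fun P : Ideal (𝓞 K) => if hP : P ∈ (Ideal (𝓞 K))⁰ then ClassGroup.mk0 ⟨P, hP⟩ else 1) (t := T) ?_]
  · apply Finset.sum_congr rfl
    intro C hC
    rw [primeIdealClassCount, ← Set.ncard_coe_finset]
    congr 1
    ext P
    simp only [Finset.coe_filter, Set.Finite.mem_toFinset, Set.mem_setOf_eq, primeIdealsInClassLE,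
      hSdef]
    constructor
    · rintro ⟨⟨h1, h2, hP, hT⟩, hc⟩
      refine ⟨h1, h2, hP, ?_⟩
      rw [dif_pos hP] at hc; exact hc
    · rintro ⟨h1, h2, hP, hc⟩
      refine ⟨⟨h1, h2, hP, ?_⟩, ?_⟩
      · rw [hc]; exact hC
      · show (if hP : P ∈ (Ideal (𝓞 K))⁰ then ClassGroup.mk0 ⟨P, hP⟩ else 1) = C
        rw [dif_pos hP]; exact hc
  · intro P hPS
    rw [Finset.mem_coe, Set.Finite.mem_toFinset] at hPS
    obtain ⟨-, -, hP, hT⟩ := hPS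
    rw [Finset.mem_coe]
    show (if hP' : P ∈ (Ideal (𝓞 K))⁰ then ClassGroup.mk0 ⟨P, hP'⟩ else 1) ∈ T
    rw [dif_pos hP]; exact hT


open Classical in
/-- `π_K(x) = ∑_C π_C(x)`. [folklore] -/
theorem primeIdealCount_eq_sum_classCount (K : Type) [Field K] [NumberField K] (x : ℝ) :
    primeIdealCount K x = ∑ C : ClassGroup (𝓞 K), primeIdealClassCount K C x := by
  rw [← ncard_primes_class_mem_eq_sum K x Finset.univ, primeIdealCount]
  congr 1
  ext P
  simp only [primeIdealsLE, Set.mem_setOf_eq, Finset.mem_univ, exists_prop, and_true]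
  constructor
  · rintro ⟨h1, h2, h3⟩
    exact ⟨h1, h3, mem_nonZeroDivisors_of_ne_zero h2⟩
  · rintro ⟨h1, h2, h3⟩
    exact ⟨h1, nonZeroDivisors.ne_zero h3, h2⟩

end Summit.QuantumAdvantage.QuantumAdvantage.Theorems.DegreeOnePrimesEscape.Dock

namespace Summit.QuantumAdvantage.QuantumAdvantage.Theorems.DegreeOnePrimesEscape

/-- **The upper shadow from the Thorner–Zaman fact** (sum the class-by-class dichotomy over
`C ∈ M`; `∑_{C ∈ M} χ₁(C) ∈ {0, |M|}` is `≥ 0`, so the `Li(x^{β₁})` term is dropped; the relative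
error `c₃ E(x) ≤ 1/32` once `x ≥ Q^{C₀}`): an absolute `C₀` with
`32 · [Cl(K):M] · #{𝔭 prime, N𝔭 ≤ x, [𝔭] ∈ M} ≤ 33 · Li(x)` for all `K` of degree `> 1`,
`x ≥ Q^{C₀}`, `M ≤ Cl(K)`.  Registered stub `stub_upperShadow` (line `dedekind-s3-collision`). -/
theorem stub_upperShadow : ThornerZaman2019_classPNT_hilbertClassField →
    ∃ C₀ : ℝ, ∀ (K : Type) [Field K] [NumberField K], 1 < Module.finrank ℚ K →
      ∀ x : ℝ, ThornerZaman.condQn K ^ C₀ ≤ x →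
      ∀ M : Subgroup (ClassGroup (𝓞 K)),
        32 * (M.index : ℝ) *
            (Set.ncard {P : Ideal (𝓞 K) | P.IsPrime ∧ (Ideal.absNorm P : ℝ) ≤ x ∧
                ∃ hP : P ∈ (Ideal (𝓞 K))⁰, ClassGroup.mk0 ⟨P, hP⟩ ∈ M} : ℝ)
          ≤ 33 * offsetLogIntegral x := by
  intro hTZ
  classical
  obtain ⟨C₀, hC₀⟩ := Dock.subgroupClassSum_le_of_TZ hTZ
  refine ⟨C₀, fun K _ _ hK x hx M => ?_⟩
  have hset : {P : Ideal (𝓞 K) | P.IsPrime ∧ (Ideal.absNorm P : ℝ) ≤ x ∧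
        ∃ hP : P ∈ (Ideal (𝓞 K))⁰, ClassGroup.mk0 ⟨P, hP⟩ ∈ M}
      = {P : Ideal (𝓞 K) | P.IsPrime ∧ (Ideal.absNorm P : ℝ) ≤ x ∧
        ∃ hP : P ∈ (Ideal (𝓞 K))⁰, ClassGroup.mk0 ⟨P, hP⟩ ∈ Finset.univ.filter (· ∈ M)} := by
    ext P; simp
  have h := hC₀ K hK x hx M
  rw [hset, Dock.ncard_primes_class_mem_eq_sum K x (Finset.univ.filter (· ∈ M))]
  push_cast
  convert h using 2

end Summit.QuantumAdvantage.QuantumAdvantage.Theorems.DegreeOnePrimesEscape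

end
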